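import Mathlib
import Literature.NumberTheory.LFunctions.Zhang2022.Section16AEq165Assembly
import Literature.NumberTheory.LFunctions.Zhang2022.Section16Eq164Mellin
import Literature.NumberTheory.LFunctions.Zhang2022.ToolkitDivisorMajorants
import HarnessLib

/-!
# Zhang (2022) §16, u015 ⇒ u017 ⇒ u018: "This yields … Hence
# `Σ_d g̃₂(dk)/d Σ_{(l,k)=1}(κ₂∗b₁)(dl)χ(l)Δ(l/(Dpk)) = ℛ₂*Dpk ΣΣ g̃₂(d₁d₂k)/(d₁d₂) κ̃₂(d₁;d₂k)λ₂(d₁d₂k) Σ b₁(d₂l₂)χ(l₂)/l₂ + O(α²⁰Dpk)`"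
# — the EDGE `u015 (on the support of b₁) ⇒ u018`, kernel-checked

Topic `Literature/NumberTheory/LFunctions/Zhang2022` (Landau–Siegel audit tree; verdict-neutral).
Y. Zhang, *Discrete mean estimates and the Landau–Siegel zero*, arXiv:2211.02515v1 (2022)
[Zhang2022LandauSiegel] — **an unrefereed manuscript under adjudication** (ZHANG-L discharge lane, WP16,
chain of the leaf `Typed.Section16A.Eq16_12 c′`). The displays are CLAIM nodes of
`Zhang2022/TypedSection16A.lean`, stated not asserted: §16.u011 `Step16_u011` [Z22 p. 89, tex L4460] (a tree
THEOREM, `Typed.Section16A.step16_u011_holds`, zl-libC-p5), §16.u015 `Step16_u015` [p. 90, tex L4484], §16.u017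
`Step16_u017` [tex L4494], §16.u018 `Step16_u018` [tex L4502].

This theorem-only file PROVES `step16_u018_of_u015w : (u015 on the support of b₁) → Step16_u018 c′`, where the
hypothesis is the display u015 VERBATIM except that its printed range «`l₂ < P₂²`» is replaced by
«`l₂ < 2T²·P^{1/2}·max(P₂,P₃)`» (`= 2PT⁻⁸`), the support bound of `b₁`
(`Typed.Section16ALeaves.b1coef_eq_zero_of_le`) — RANGE NOTE: the weights `b₁(d₂l₂)` of u017 live on
`d₂l₂ < 2PT⁻⁸ ⊄ {l₂ < P₂² = PT⁻²⁰}`, so the printed range does not suffice for the insertion, while the text's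
only use of it («Note that `Dpk/l₂ > T` if `l₂ < P₂²`») survives (`Dpk/l₂ > DT⁸/2`). The u017 display is passed
through in the form the divisor majorants actually give (weight `τ₅(d) = (τ₂∗τ₃)(d)` from `τ₂(d₁)` of u015 and
`|b₁| ≤ C_bτ₃`, with a factor `(2+𝓛⁹)³`; the printed `O(α⁵⁰τ₃(d)Dpk)` of u017 is not targeted and not needed:
u018's `O(α²⁰Dpk)` absorbs `α⁸⁰·𝓛^{72}`):

* termwise insertion of u015 into u011's right side (`‖χ(l₂)‖ ≤ 1`; terms with `b₁(d₂l₂) = 0` vanish, the others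
  have `l₂` in the support range and `d₁d₂k = dk < 2P₄`);
* `Σ_{l₂≤N}|b₁(d₂l₂)|/l₂ ≤ C_bτ₃(d₂)(1+log N)³` (`Skeleton.norm_b1coef_le`, `MeanSquareMajorant.sum_tau_mul_div_Icc_le`),
  `Σ_{d=d₁d₂}τ₂(d₁)τ₃(d₂) = τ₅(d)` (`tau_add_apply`), `Σ_{d≤K}τ₅(d)/d ≤ (1+log K)⁵` (`sum_tau_div_Icc_le_log_pow`);
* the exact regrouping `Σ_{d≤2P₄} g̃₂(dk)/d·Σ_{d=d₁d₂}(…) = Σ_{d₁,d₂≤2P₄} g̃₂(d₁d₂k)/(d₁d₂)(…)` (pairs with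
  `d₁d₂ > 2P₄` carry `g̃₂(d₁d₂k) = 0`; `Typed.Section16A.sum_Ico_Ico_eq_sum_divisorsAntidiagonal`);
* `|g̃₂| ≤ 1` (`Skeleton.norm_gTilde16_le`), `d` with `dk ≥ 2P₄` contribute nothing, `α⁸⁰𝓛^{72} ≤ π⁸⁰` (`α𝓛⁹ = π`).

No new definitions, no named facts, no `sorry`; u015 (wide) is a hypothesis, never asserted. Nothing here bears on
Theorems 1–2 of the source or on Landau–Siegel zeros.

## References

* Y. Zhang, arXiv:2211.02515v1 (2022), §16 pp. 89–90, u011 tex L4460, u015 tex L4484, u017 tex L4494, u018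
  tex L4502. [cite: Zhang2022LandauSiegel, §16 p.90 (u018)]
-/

noncomputable section

open Complex Real
open Literature.NumberTheory.LFunctions.Zhang2022
open Literature.NumberTheory.LFunctions.Zhang2022.Skeleton
open Literature.NumberTheory.LFunctions.Zhang2022.Typed.Section16ALeaves

namespace Literature.NumberTheory.LFunctions.Zhang2022.Typed.Section16A

/-! ## Thresholds and small numerics -/

/-- `L₀ ≤ log D` once `D ≥ ⌈exp L₀⌉₊`. [folklore] -/
private theorem le_ell_of_ceil_exp_le' {L₀ : ℝ} {D : ℕ} (hD : ⌈Real.exp L₀⌉₊ ≤ D) : L₀ ≤ ell D := by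
  have h : Real.exp L₀ ≤ D := le_trans (Nat.le_ceil _) (by exact_mod_cast hD)
  exact (Real.le_log_iff_exp_le (lt_of_lt_of_le (Real.exp_pos _) h)).mpr h

/-- `1 + log ⌈P⌉ ≤ 3𝓛⁹` for `𝓛 ≥ 1` (`⌈P⌉ ≤ 2P`, `log P = 𝓛⁹`). [cite: Zhang2022LandauSiegel, §2 (2.6)] -/
private theorem one_add_log_ceil_bigP_le {D : ℕ} (hℓ : 1 ≤ ell D) :
    1 + Real.log (⌈bigP D⌉₊ : ℝ) ≤ 3 * ell D ^ 9 := by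
  have hP1 : 1 ≤ bigP D := by rw [bigP]; exact Real.one_le_exp (by positivity)
  have hN : (⌈bigP D⌉₊ : ℝ) ≤ 2 * bigP D := by
    have := Nat.ceil_lt_add_one (show (0 : ℝ) ≤ bigP D by linarith)
    linarith
  have hNpos : (0 : ℝ) < (⌈bigP D⌉₊ : ℝ) := by
    have : (1 : ℝ) ≤ (⌈bigP D⌉₊ : ℝ) := by exact_mod_cast Nat.one_le_ceil_iff.mpr (by linarith)
    linarith
  have hlog : Real.log (⌈bigP D⌉₊ : ℝ) ≤ Real.log 2 + ell D ^ 9 := by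
    calc Real.log (⌈bigP D⌉₊ : ℝ) ≤ Real.log (2 * bigP D) := Real.log_le_log hNpos hN
      _ = Real.log 2 + ell D ^ 9 := by rw [Real.log_mul (by norm_num) (by linarith), bigP, Real.log_exp]
  have hℓ9 : 1 ≤ ell D ^ 9 := one_le_pow₀ hℓ
  linarith [Real.log_two_lt_d9]

/-- `1 + log ⌊2P₄⌋ ≤ 522𝓛⁹` for `𝓛 ≥ 1` (`2P₄ ≤ 2Pt₀`, `log t₀ = 519 log 𝓛 ≤ 519𝓛`).
[cite: Zhang2022LandauSiegel, §6 p.30 (P₄)] -/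
private theorem one_add_log_floor_two_P4_le {D : ℕ} (hℓ : 1 ≤ ell D) :
    1 + Real.log (⌊2 * P4 D⌋₊ : ℝ) ≤ 522 * ell D ^ 9 := by
  have hℓ0 : 0 < ell D := by linarith
  have hP0 : 0 < bigP D := Real.exp_pos _
  have ht0 : 0 < t0 D := by rw [t0]; positivity
  have hT1 : 1 ≤ bigT D ^ 2 := one_le_pow₀ (by rw [bigT]; exact Real.one_le_exp (by positivity))
  have hP4le : 2 * P4 D ≤ 2 * (bigP D * t0 D) := by
    rw [P4]
    have : bigP D / bigT D ^ 2 * t0 D ≤ bigP D * t0 D :=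
      mul_le_mul_of_nonneg_right (div_le_self hP0.le hT1) ht0.le
    linarith
  have hℓ9 : 1 ≤ ell D ^ 9 := one_le_pow₀ hℓ
  have hlog : Real.log (⌊2 * P4 D⌋₊ : ℝ) ≤ 1 + 520 * ell D ^ 9 := by
    rcases Nat.eq_zero_or_pos ⌊2 * P4 D⌋₊ with h0 | hpos
    · rw [h0, Nat.cast_zero, Real.log_zero]; positivity
    have hKpos : (0 : ℝ) < (⌊2 * P4 D⌋₊ : ℝ) := by exact_mod_cast hpos
    have hKle : (⌊2 * P4 D⌋₊ : ℝ) ≤ 2 * (bigP D * t0 D) :=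
      (Nat.floor_le (by linarith [P4_nonneg D])).trans hP4le
    have hlog2 : Real.log 2 < 1 := by linarith [Real.log_two_lt_d9]
    have hlogt : Real.log (t0 D) ≤ 519 * ell D := by
      rw [t0, Real.log_pow]
      push_cast
      exact mul_le_mul_of_nonneg_left (Real.log_le_self hℓ0.le) (by norm_num)
    have hℓ9' : ell D ≤ ell D ^ 9 := le_self_pow₀ hℓ (by norm_num)
    calc Real.log (⌊2 * P4 D⌋₊ : ℝ) ≤ Real.log (2 * (bigP D * t0 D)) := Real.log_le_log hKpos hKle
      _ = Real.log 2 + (ell D ^ 9 + Real.log (t0 D)) := by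
          rw [Real.log_mul (by norm_num) (by positivity), Real.log_mul hP0.ne' ht0.ne', bigP, Real.log_exp]
      _ ≤ 1 + (ell D ^ 9 + 519 * ell D) := by linarith
      _ ≤ 1 + 520 * ell D ^ 9 := by nlinarith
  linarith

/-- `α⁸⁰·(𝓛⁹)⁸ ≤ π⁸⁰` for `𝓛 ≥ 1` (`α𝓛⁹ = π`, `α ≤ π`). [cite: Zhang2022LandauSiegel, §2 (2.10)] -/
private theorem alpha_pow_eighty_mul_le {D : ℕ} (hℓ : 1 ≤ ell D) :
    alpha D ^ 80 * (ell D ^ 9) ^ 8 ≤ π ^ 80 := by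
  have hℓ0 : 0 < ell D := by linarith
  have hα := alpha_mul_ell_pow_nine (D := D) hℓ0
  have hα0 : 0 ≤ alpha D := (alpha_pos_of_ell_pos hℓ0).le
  have hu1 : 1 ≤ ell D ^ 9 := one_le_pow₀ hℓ
  have hαπ : alpha D ≤ π := by
    calc alpha D = alpha D * 1 := (mul_one _).symm
      _ ≤ alpha D * ell D ^ 9 := mul_le_mul_of_nonneg_left hu1 hα0
      _ = π := hα
  have h8 : alpha D ^ 8 * (ell D ^ 9) ^ 8 = π ^ 8 := by rw [← mul_pow, hα]
  have h72 : alpha D ^ 72 ≤ π ^ 72 := pow_le_pow_left₀ hα0 hαπ 72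
  calc alpha D ^ 80 * (ell D ^ 9) ^ 8 = alpha D ^ 72 * (alpha D ^ 8 * (ell D ^ 9) ^ 8) := by ring
    _ = alpha D ^ 72 * π ^ 8 := by rw [h8]
    _ ≤ π ^ 72 * π ^ 8 := mul_le_mul_of_nonneg_right h72 (by positivity)
    _ = π ^ 80 := by ring

section Main

variable (c' : ℝ)

/-- **u015 (on the support of `b₁`) ⇒ u018** (§16 p. 90, tex L4484–L4508: "Thus [u015] … This yields [u017] …
Hence [u018]"): from the display u015 with its range widened to `l₂ < 2T²P^{1/2}max(P₂,P₃)` (the support of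
`b₁`; everything else verbatim), the display u018 `Typed.Section16A.Step16_u018 c′` follows — u011 is the tree
theorem `step16_u011_holds`, the insertion costs `Σ_{d≤2P₄}(1/d)Σ_{d=d₁d₂}τ₂(d₁)·C_bτ₃(d₂)(1+log⌈P⌉)³ ≤
C_b(3𝓛⁹)³(522𝓛⁹)⁵-type`, times `Cα¹⁰⁰Dpk`, which is `≤ C′α²⁰Dpk` since `α⁸⁰𝓛^{72} ≤ π⁸⁰`.
[cite: Zhang2022LandauSiegel, §16 p.90 (u015–u018)] -/
theorem step16_u018_of_u015w
    (h15 : ∃ C : ℝ, ForAllLarge fun D _ χ => AssumptionA D χ →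
      ∀ p ∈ primeWindow D, ∀ d₁ d₂ k l₂ : ℕ, 1 ≤ d₁ → 1 ≤ d₂ → 1 ≤ k → 1 ≤ l₂ →
        (l₂ : ℝ) < 2 * bigT D ^ 2 * (bigP D ^ (1 / 2 : ℝ) * max (Skeleton.P2 D) (P3 D)) →
        ((d₁ * d₂ * k : ℕ) : ℝ) < 2 * P4 D →
        ‖(∑' l₁ : ℕ, if Nat.Coprime l₁ (d₂ * k) then
              kappa2 c' D (d₁ * l₁) * χ (l₁ : ZMod D) *
                DeltaW D (((l₁ * l₂ : ℕ) : ℝ) / ((D : ℝ) * p * k))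
            else 0) -
            calR2star c' χ * (((D : ℝ) * p * k / l₂ : ℝ) : ℂ) * kappaTilde2 c' χ d₁ (d₂ * k) 1 *
              lam2 c' χ (d₁ * d₂ * k) 1‖ ≤
          C * alpha D ^ 100 * d₁.divisors.card * ((D : ℝ) * p * k / l₂)) :
    Step16_u018 c' := by
  obtain ⟨C, h15'⟩ := h15
  set C' : ℝ := max C 0 with hC'
  have hC'0 : 0 ≤ C' := le_max_right _ _
  set Cb : ℝ := (1 + ‖iota2‖) * (‖iota3‖ + ‖iota4‖) with hCb
  have hCb0 : 0 ≤ Cb := by positivity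
  refine ⟨C' * Cb * (3 ^ 3 * 522 ^ 5) * π ^ 80, ?_⟩
  obtain ⟨D₁, h₁⟩ := h15'.and (step16_u011_holds c')
  refine ⟨max D₁ ⌈Real.exp 10⌉₊, fun D _ χ hD hq hp hA p hpW k hk1 hkP4 => ?_⟩
  have hD₁ : D₁ ≤ D := le_trans (le_max_left _ _) hD
  have hℓ10 : 10 ≤ ell D := le_ell_of_ceil_exp_le' (le_trans (le_max_right _ _) hD)
  have hℓ1 : 1 ≤ ell D := by linarith
  have hℓ2 : 2 ≤ ell D := by linarith
  have hℓ0 : 0 < ell D := by linarith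
  obtain ⟨e15, e11⟩ := h₁ D χ hD₁ hq hp
  have h15p := e15 hA p hpW
  have h11p := e11 p hpW
  have hp0 : 0 < p := (Finset.mem_filter.mp hpW).2.pos
  have hpR : (0 : ℝ) < p := by exact_mod_cast hp0
  have hD0 : (0 : ℝ) < D := by exact_mod_cast NeZero.pos D
  have hkR : (0 : ℝ) < k := by exact_mod_cast hk1
  have hα0 : 0 ≤ alpha D := (alpha_pos_of_ell_pos hℓ0).le
  have hα100 : 0 ≤ alpha D ^ 100 := pow_nonneg hα0 100
  set K : ℕ := ⌊2 * P4 D⌋₊ with hK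
  set N : ℕ := ⌈bigP D⌉₊ with hN
  set R : ℂ := calR2star c' χ with hR
  set X : ℝ := (D : ℝ) * p * k with hX
  have hX0 : 0 < X := by positivity
  set Sb : ℝ := 2 * bigT D ^ 2 * (bigP D ^ (1 / 2 : ℝ) * max (Skeleton.P2 D) (P3 D)) with hSb
  set Lf : Finset ℕ := (Finset.Ico 1 N).filter (fun l₂ => Nat.Coprime l₂ k) with hLf
  -- the inner series `I(e,l₂)`, its main term, the `l`-series `T(d)` and its main part `M(d)`
  set I : ℕ × ℕ → ℕ → ℂ := fun e l₂ => ∑' l₁ : ℕ, if Nat.Coprime l₁ (e.2 * k) then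
      kappa2 c' D (e.1 * l₁) * χ (l₁ : ZMod D) * DeltaW D (((l₁ * l₂ : ℕ) : ℝ) / X) else 0 with hI
  set mI : ℕ × ℕ → ℕ → ℂ := fun e l₂ =>
      R * ((X / l₂ : ℝ) : ℂ) * kappaTilde2 c' χ e.1 (e.2 * k) 1 * lam2 c' χ (e.1 * e.2 * k) 1 with hmI
  set T : ℕ → ℂ := fun d => ∑' l : ℕ, if Nat.Coprime l k then
      kappa2Star c' χ (d * l) * χ (l : ZMod D) * DeltaW D ((l : ℝ) / X) else 0 with hT
  set M : ℕ → ℂ := fun d => ∑ e ∈ d.divisorsAntidiagonal, ∑ l₂ ∈ Lf,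
      b1coef c' χ (e.2 * l₂) * χ (l₂ : ZMod D) * mI e l₂ with hM
  -- the u018 main summand
  set f : ℕ × ℕ → ℂ := fun q => gTilde16 c' D ((q.1 * q.2 * k : ℕ) : ℝ) / ((q.1 : ℂ) * q.2) *
      kappaTilde2 c' χ q.1 (q.2 * k) 1 * lam2 c' χ (q.1 * q.2 * k) 1 *
      ∑ l₂ ∈ Lf, b1coef c' χ (q.2 * l₂) * χ (l₂ : ZMod D) / (l₂ : ℂ) with hf
  -- (1) u011: `T(d) = Σ_e Σ_{l₂} b₁χ · I`
  have hTe : ∀ d : ℕ, 1 ≤ d → T d = ∑ e ∈ d.divisorsAntidiagonal, ∑ l₂ ∈ Lf,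
      b1coef c' χ (e.2 * l₂) * χ (l₂ : ZMod D) * I e l₂ := fun d hd => h11p d k hd hk1
  -- (2) the insertion bound for one `d` with `dk < 2P₄`
  set u : ℝ := ell D ^ 9 with hu
  have hlogN : 1 + Real.log (N : ℝ) ≤ 3 * u := one_add_log_ceil_bigP_le hℓ1
  have hlogN0 : 0 ≤ 1 + Real.log (N : ℝ) := by
    have := Real.log_natCast_nonneg N; linarith
  have hTM : ∀ d ∈ Finset.Icc 1 K, ((d * k : ℕ) : ℝ) < 2 * P4 D →
      ‖T d - M d‖ ≤ C' * alpha D ^ 100 * X * (Cb * (1 + Real.log (N : ℝ)) ^ 3) *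
        MeanSquareMajorant.tau 5 d := by
    intro d hd hdk
    have hd1 : 1 ≤ d := (Finset.mem_Icc.mp hd).1
    rw [hTe d hd1]
    simp only [hM]
    rw [← Finset.sum_sub_distrib]
    have hinner : ∀ e ∈ d.divisorsAntidiagonal,
        ‖(∑ l₂ ∈ Lf, b1coef c' χ (e.2 * l₂) * χ (l₂ : ZMod D) * I e l₂) -
            ∑ l₂ ∈ Lf, b1coef c' χ (e.2 * l₂) * χ (l₂ : ZMod D) * mI e l₂‖ ≤
          C' * alpha D ^ 100 * X * (Cb * (1 + Real.log (N : ℝ)) ^ 3) *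
            (MeanSquareMajorant.tau 2 e.1 * MeanSquareMajorant.tau 3 e.2) := by
      intro e he
      obtain ⟨hprod, hd0⟩ := Nat.mem_divisorsAntidiagonal.mp he
      have he1 : 1 ≤ e.1 := Nat.one_le_iff_ne_zero.mpr fun h => hd0 (by rw [← hprod, h, zero_mul])
      have he2 : 1 ≤ e.2 := Nat.one_le_iff_ne_zero.mpr fun h => hd0 (by rw [← hprod, h, mul_zero])
      have hdk' : ((e.1 * e.2 * k : ℕ) : ℝ) < 2 * P4 D := by rw [hprod]; exact hdk
      rw [← Finset.sum_sub_distrib]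
      -- termwise
      have hterm : ∀ l₂ ∈ Lf,
          ‖b1coef c' χ (e.2 * l₂) * χ (l₂ : ZMod D) * I e l₂ -
              b1coef c' χ (e.2 * l₂) * χ (l₂ : ZMod D) * mI e l₂‖ ≤
            ‖b1coef c' χ (e.2 * l₂)‖ / (l₂ : ℝ) * (C' * alpha D ^ 100 * (e.1.divisors.card : ℝ) * X) := by
        intro l₂ hl₂
        have hl₂1 : 1 ≤ l₂ := (Finset.mem_Ico.mp (Finset.mem_filter.mp hl₂).1).1
        have hl₂R : (0 : ℝ) < l₂ := by exact_mod_cast hl₂1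
        rw [← mul_sub, norm_mul, norm_mul]
        by_cases hb : b1coef c' χ (e.2 * l₂) = 0
        · rw [hb]; simp
        have hrange : (l₂ : ℝ) < Sb := by
          have h1 : ((e.2 * l₂ : ℕ) : ℝ) < Sb := by
            by_contra hge
            exact hb (b1coef_eq_zero_of_le c' χ (not_lt.mp hge))
          have h2 : (l₂ : ℝ) ≤ ((e.2 * l₂ : ℕ) : ℝ) := by exact_mod_cast Nat.le_mul_of_pos_left l₂ he2
          linarith
        have hu := h15p e.1 e.2 k l₂ he1 he2 hk1 hl₂1 hrange hdk'
        have hχ1 : ‖χ (l₂ : ZMod D)‖ ≤ 1 := DirichletCharacter.norm_le_one χ _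
        calc ‖b1coef c' χ (e.2 * l₂)‖ * ‖χ (l₂ : ZMod D)‖ * ‖I e l₂ - mI e l₂‖
            ≤ ‖b1coef c' χ (e.2 * l₂)‖ * 1 * (C * alpha D ^ 100 * (e.1.divisors.card : ℝ) * (X / l₂)) := by
              refine mul_le_mul (mul_le_mul_of_nonneg_left hχ1 (norm_nonneg _)) ?_ (norm_nonneg _)
                (mul_nonneg (norm_nonneg _) zero_le_one)
              simpa only [hI, hmI, hX] using hu
          _ ≤ ‖b1coef c' χ (e.2 * l₂)‖ * 1 * (C' * alpha D ^ 100 * (e.1.divisors.card : ℝ) * (X / l₂)) := by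
              refine mul_le_mul_of_nonneg_left ?_ (mul_nonneg (norm_nonneg _) zero_le_one)
              have hw : 0 ≤ alpha D ^ 100 * (e.1.divisors.card : ℝ) * (X / l₂) :=
                mul_nonneg (mul_nonneg hα100 (Nat.cast_nonneg _)) (div_nonneg hX0.le hl₂R.le)
              calc C * alpha D ^ 100 * (e.1.divisors.card : ℝ) * (X / l₂)
                  = C * (alpha D ^ 100 * (e.1.divisors.card : ℝ) * (X / l₂)) := by ring
                _ ≤ C' * (alpha D ^ 100 * (e.1.divisors.card : ℝ) * (X / l₂)) :=
                    mul_le_mul_of_nonneg_right (le_max_left _ _) hw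
                _ = C' * alpha D ^ 100 * (e.1.divisors.card : ℝ) * (X / l₂) := by ring
          _ = ‖b1coef c' χ (e.2 * l₂)‖ / (l₂ : ℝ) * (C' * alpha D ^ 100 * (e.1.divisors.card : ℝ) * X) := by
              field_simp
      refine (norm_sum_le _ _).trans ((Finset.sum_le_sum hterm).trans ?_)
      rw [← Finset.sum_mul]
      -- `Σ_{l₂ ∈ Lf} |b₁(e.2 l₂)|/l₂ ≤ C_b τ₃(e.2) (1 + log N)³`
      have hbsum : ∑ l₂ ∈ Lf, ‖b1coef c' χ (e.2 * l₂)‖ / (l₂ : ℝ) ≤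
          Cb * MeanSquareMajorant.tau 3 e.2 * (1 + Real.log (N : ℝ)) ^ 3 := by
        have hsub : Lf ⊆ Finset.Icc 1 N := by
          intro l hl
          have := Finset.mem_Ico.mp (Finset.mem_filter.mp hl).1
          simp only [Finset.mem_Icc]; omega
        calc ∑ l₂ ∈ Lf, ‖b1coef c' χ (e.2 * l₂)‖ / (l₂ : ℝ)
            ≤ ∑ l₂ ∈ Finset.Icc 1 N, ‖b1coef c' χ (e.2 * l₂)‖ / (l₂ : ℝ) :=
              Finset.sum_le_sum_of_subset_of_nonneg hsub fun l _ _ => by positivity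
          _ ≤ ∑ l₂ ∈ Finset.Icc 1 N, Cb * (MeanSquareMajorant.tau 3 (e.2 * l₂) / (l₂ : ℝ)) :=
              Finset.sum_le_sum fun l₂ hl₂ => by
                have hb := Skeleton.norm_b1coef_le c' χ hℓ2 (e.2 * l₂)
                rw [one_mul] at hb
                rw [← mul_div_assoc]
                exact div_le_div_of_nonneg_right hb (Nat.cast_nonneg _)
          _ = Cb * ∑ l₂ ∈ Finset.Icc 1 N, MeanSquareMajorant.tau 3 (e.2 * l₂) / (l₂ : ℝ) := by
              rw [Finset.mul_sum]
          _ ≤ Cb * (MeanSquareMajorant.tau 3 e.2 * (1 + Real.log (N : ℝ)) ^ 3) :=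
              mul_le_mul_of_nonneg_left (MeanSquareMajorant.sum_tau_mul_div_Icc_le 3 e.2 N) hCb0
          _ = _ := by ring
      have hτ2 : (e.1.divisors.card : ℝ) = MeanSquareMajorant.tau 2 e.1 :=
        (MeanSquareMajorant.tau_two_apply e.1).symm
      rw [hτ2]
      have hτ20 : 0 ≤ MeanSquareMajorant.tau 2 e.1 := MeanSquareMajorant.tau_nonneg _ _
      calc (∑ l₂ ∈ Lf, ‖b1coef c' χ (e.2 * l₂)‖ / (l₂ : ℝ)) *
            (C' * alpha D ^ 100 * MeanSquareMajorant.tau 2 e.1 * X)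
          ≤ (Cb * MeanSquareMajorant.tau 3 e.2 * (1 + Real.log (N : ℝ)) ^ 3) *
            (C' * alpha D ^ 100 * MeanSquareMajorant.tau 2 e.1 * X) :=
            mul_le_mul_of_nonneg_right hbsum (mul_nonneg (mul_nonneg (mul_nonneg hC'0 hα100) hτ20) hX0.le)
        _ = _ := by ring
    refine (norm_sum_le _ _).trans ((Finset.sum_le_sum hinner).trans ?_)
    rw [← Finset.mul_sum, show (5 : ℕ) = 2 + 3 from rfl, MeanSquareMajorant.tau_add_apply]
  -- (3) the exact regrouping of the main terms
  have hMf : ∀ d ∈ Finset.Icc 1 K,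
      gTilde16 c' D ((d * k : ℕ) : ℝ) / (d : ℂ) * M d =
        R * (X : ℂ) * ∑ e ∈ d.divisorsAntidiagonal, f e := by
    intro d hd
    simp only [hM, hf]
    rw [Finset.mul_sum, Finset.mul_sum]
    refine Finset.sum_congr rfl fun e he => ?_
    obtain ⟨hprod, _⟩ := Nat.mem_divisorsAntidiagonal.mp he
    rw [Finset.mul_sum, Finset.mul_sum, Finset.mul_sum]
    refine Finset.sum_congr rfl fun l₂ _ => ?_
    simp only [hmI]
    rw [← hprod]
    push_cast
    ring
  have hregroup : ∑ d ∈ Finset.Icc 1 K, gTilde16 c' D ((d * k : ℕ) : ℝ) / (d : ℂ) * M d =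
      R * (X : ℂ) * ∑ d₁ ∈ Finset.Icc 1 K, ∑ d₂ ∈ Finset.Icc 1 K, f (d₁, d₂) := by
    rw [Finset.sum_congr rfl hMf, ← Finset.mul_sum, ← Finset.Ico_add_one_right_eq_Icc,
      sum_Ico_Ico_eq_sum_divisorsAntidiagonal (K + 1) f]
    intro q hq1 hq2 hq
    -- `q.1 q.2 ≥ K + 1 > 2P₄` ⇒ `g̃₂(q.1 q.2 k) = 0`
    have hgt : 2 * P4 D < ((q.1 * q.2 : ℕ) : ℝ) := by
      have h1 : 2 * P4 D < (K : ℝ) + 1 := Nat.lt_floor_add_one _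
      have h2 : (K : ℝ) + 1 ≤ ((q.1 * q.2 : ℕ) : ℝ) := by exact_mod_cast hq
      linarith
    have hle : ((q.1 * q.2 : ℕ) : ℝ) ≤ ((q.1 * q.2 * k : ℕ) : ℝ) := by
      exact_mod_cast Nat.le_mul_of_pos_right _ hk1
    have hpos : (0 : ℝ) < ((q.1 * q.2 * k : ℕ) : ℝ) := by
      have : 0 ≤ 2 * P4 D := by have := P4_nonneg D; positivity
      linarith
    simp only [hf]
    rw [gTilde16_eq_zero_of_le c' hpos (by linarith), zero_div, zero_mul, zero_mul, zero_mul]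
  -- (4) the difference as `Σ_d g̃₂(dk)/d (T d − M d)`
  have hdiff : (∑ d ∈ Finset.Icc 1 K, gTilde16 c' D ((d * k : ℕ) : ℝ) / (d : ℂ) * T d) -
      R * (X : ℂ) * ∑ d₁ ∈ Finset.Icc 1 K, ∑ d₂ ∈ Finset.Icc 1 K, f (d₁, d₂) =
      ∑ d ∈ Finset.Icc 1 K, gTilde16 c' D ((d * k : ℕ) : ℝ) / (d : ℂ) * (T d - M d) := by
    rw [← hregroup, ← Finset.sum_sub_distrib]
    refine Finset.sum_congr rfl fun d _ => ?_
    ring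
  -- (5) per-`d` bound of the weighted difference, including `dk ≥ 2P₄` (then `g̃₂(dk) = 0`)
  have hlogK : 1 + Real.log (K : ℝ) ≤ 522 * u := one_add_log_floor_two_P4_le hℓ1
  have hlogK0 : 0 ≤ 1 + Real.log (K : ℝ) := by
    have := Real.log_natCast_nonneg K; linarith
  set Wc : ℝ := C' * alpha D ^ 100 * X * (Cb * (1 + Real.log (N : ℝ)) ^ 3) with hWc
  have hWc0 : 0 ≤ Wc :=
    mul_nonneg (mul_nonneg (mul_nonneg hC'0 hα100) hX0.le) (mul_nonneg hCb0 (pow_nonneg hlogN0 3))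
  have hper : ∀ d ∈ Finset.Icc 1 K,
      ‖gTilde16 c' D ((d * k : ℕ) : ℝ) / (d : ℂ) * (T d - M d)‖ ≤
        Wc * (MeanSquareMajorant.tau 5 d / d) := by
    intro d hd
    have hd1 : 1 ≤ d := (Finset.mem_Icc.mp hd).1
    have hdR : (0 : ℝ) < d := by exact_mod_cast hd1
    by_cases hdk : ((d * k : ℕ) : ℝ) < 2 * P4 D
    · rw [norm_mul, norm_div, Complex.norm_natCast]
      have hg : ‖gTilde16 c' D ((d * k : ℕ) : ℝ)‖ ≤ 1 := Skeleton.norm_gTilde16_le c' hℓ0 (d * k)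
      calc ‖gTilde16 c' D ((d * k : ℕ) : ℝ)‖ / d * ‖T d - M d‖
          ≤ 1 / d * (Wc * MeanSquareMajorant.tau 5 d) :=
            mul_le_mul (div_le_div_of_nonneg_right hg hdR.le) (hTM d hd hdk) (norm_nonneg _)
              (div_nonneg zero_le_one hdR.le)
        _ = Wc * (MeanSquareMajorant.tau 5 d / d) := by ring
    · have hpos : (0 : ℝ) < ((d * k : ℕ) : ℝ) := by positivity
      rw [gTilde16_eq_zero_of_le c' hpos (not_lt.mp hdk), zero_div, zero_mul, norm_zero]
      exact mul_nonneg hWc0 (div_nonneg (MeanSquareMajorant.tau_nonneg _ _) hdR.le)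
  -- (6) assemble
  have hsum5 : ∑ d ∈ Finset.Icc 1 K, MeanSquareMajorant.tau 5 d / (d : ℝ) ≤ (1 + Real.log (K : ℝ)) ^ 5 :=
    MeanSquareMajorant.sum_tau_div_Icc_le_log_pow 5 K
  have hα : alpha D ^ 80 * u ^ 8 ≤ π ^ 80 := by
    simpa only [hu] using alpha_pow_eighty_mul_le (D := D) hℓ1
  have hmain : ‖(∑ d ∈ Finset.Icc 1 K, gTilde16 c' D ((d * k : ℕ) : ℝ) / (d : ℂ) * T d) -
      R * (X : ℂ) * ∑ d₁ ∈ Finset.Icc 1 K, ∑ d₂ ∈ Finset.Icc 1 K, f (d₁, d₂)‖ ≤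
      C' * Cb * (3 ^ 3 * 522 ^ 5) * π ^ 80 * alpha D ^ 20 * X := by
    rw [hdiff]
    calc ‖∑ d ∈ Finset.Icc 1 K, gTilde16 c' D ((d * k : ℕ) : ℝ) / (d : ℂ) * (T d - M d)‖
        ≤ ∑ d ∈ Finset.Icc 1 K, Wc * (MeanSquareMajorant.tau 5 d / d) :=
          (norm_sum_le _ _).trans (Finset.sum_le_sum hper)
      _ = Wc * ∑ d ∈ Finset.Icc 1 K, MeanSquareMajorant.tau 5 d / (d : ℝ) := by rw [Finset.mul_sum]
      _ ≤ Wc * (1 + Real.log (K : ℝ)) ^ 5 := mul_le_mul_of_nonneg_left hsum5 hWc0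
      _ ≤ Wc * (522 * u) ^ 5 := mul_le_mul_of_nonneg_left (pow_le_pow_left₀ hlogK0 hlogK 5) hWc0
      _ ≤ (C' * alpha D ^ 100 * X * (Cb * (3 * u) ^ 3)) * (522 * u) ^ 5 := by
          refine mul_le_mul_of_nonneg_right ?_ (pow_nonneg (by positivity) 5)
          simp only [hWc]
          exact mul_le_mul_of_nonneg_left
            (mul_le_mul_of_nonneg_left (pow_le_pow_left₀ hlogN0 hlogN 3) hCb0)
            (mul_nonneg (mul_nonneg hC'0 hα100) hX0.le)
      _ = C' * Cb * (3 ^ 3 * 522 ^ 5) * (alpha D ^ 80 * u ^ 8) * alpha D ^ 20 * X := by ring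
      _ ≤ C' * Cb * (3 ^ 3 * 522 ^ 5) * π ^ 80 * alpha D ^ 20 * X := by
          have h0 : 0 ≤ C' * Cb * (3 ^ 3 * 522 ^ 5) := by positivity
          exact mul_le_mul_of_nonneg_right
            (mul_le_mul_of_nonneg_right (mul_le_mul_of_nonneg_left hα h0) (pow_nonneg hα0 20)) hX0.le
  -- match the statement of u018
  have hLHS : (∑ d ∈ Finset.Icc 1 K, gTilde16 c' D ((d * k : ℕ) : ℝ) / (d : ℂ) *
        ∑' l : ℕ, if Nat.Coprime l k then
          kappa2Star c' χ (d * l) * χ (l : ZMod D) * DeltaW D ((l : ℝ) / ((D : ℝ) * p * k)) else 0) =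
      ∑ d ∈ Finset.Icc 1 K, gTilde16 c' D ((d * k : ℕ) : ℝ) / (d : ℂ) * T d := by
    simp only [hT, hX]
  have hRHS : calR2star c' χ * ((D : ℝ) * p * k : ℝ) *
        ∑ d₁ ∈ Finset.Icc 1 K, ∑ d₂ ∈ Finset.Icc 1 K,
          gTilde16 c' D ((d₁ * d₂ * k : ℕ) : ℝ) / ((d₁ : ℂ) * d₂) *
            kappaTilde2 c' χ d₁ (d₂ * k) 1 * lam2 c' χ (d₁ * d₂ * k) 1 *
            ∑ l₂ ∈ (Finset.Ico 1 N).filter (fun l₂ => Nat.Coprime l₂ k),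
              b1coef c' χ (d₂ * l₂) * χ (l₂ : ZMod D) / (l₂ : ℂ) =
      R * (X : ℂ) * ∑ d₁ ∈ Finset.Icc 1 K, ∑ d₂ ∈ Finset.Icc 1 K, f (d₁, d₂) := by
    simp only [hR, hX, hf, hLf]
  rw [hLHS, hRHS]
  simpa only [hX] using hmain

end Main

end Literature.NumberTheory.LFunctions.Zhang2022.Typed.Section16A
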